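import Mathlib.Topology.Algebra.Group.Quotient
import Mathlib.GroupTheory.Commutator.Basic
import Literature.AnabelianGeometry.SemiGraphs.TemperedThetaQuotients
import HarnessLib

/-!
# [EtTh] §1: the theta quotients of `Π^tp_X` — the L2 root's axioms as theorems (group level)

Mochizuki, *The étale theta function and its Frobenioid-theoretic manifestations*, Publ. RIMS **45**
(2009), §1, PRIMS PDF p. 12 (printed 238): "we shall write `Π^tp_X ↠ (Π^tp_X)^Θ ↠ (Π^tp_X)^ell`
for the quotients whose kernels are the kernels of the quotients `Δ^tp_X ↠ (Δ^tp_X)^Θ ↠ (Δ^tp_X)^ell`"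
induced by "`Δ_X ↠ Δ^Θ_X := Δ_X/[Δ_X,[Δ_X,Δ_X]] ↠ Δ^ell_X := Δ^ab_X`", and "a natural exact sequence
`1 → Δ_Θ → (Δ^tp_X)^Θ → (Δ^tp_X)^ell → 1`" with `Δ_Θ ≅ Ẑ(1)` central [cite: MochizukiEtTh2009, §1 p.12].

Cell abc-iut, layer L2, unit W2-L2-03 (merge adapter, GROUP level per L3 ruling η): the [EtTh] §1
root `EtaleTheta/Setting.lean` (v3, seat abc-iut-L2-t1) carries the theta quotients
`Π^tp_X ↠ (Π^tp_X)^Θ ↠ (Π^tp_X)^ell` as DATA with `Prop` fields `ker_toTheta`, `ker_toEll`,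
`ker_thetaToEll_comm`, `ker_thetaToEll_central`, `continuous_toTheta`, `toTheta_surjective`,
`continuous_thetaToEll`, `thetaToEll_surjective` (TODO-merge abc-iut-L3-t2). Layer L3 (seat
abc-iut-L3-t2, `SemiGraphs/TemperedThetaQuotients.lean`) DEFINES these quotients for the group-level
interface `OncePuncturedTemperedGroup K`: `thetaKer = Δ^tp_X ⊓ toHat⁻¹([Δ_X,[Δ_X,Δ_X]]⁻)`,
`ellKer`, `PiTheta = Π^tp_X/thetaKer`, `PiEll`, `piThetaToEll`, `deltaTpTheta = (Δ^tp_X)^Θ`. This file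
PROVES that the L3 definitions satisfy every one of the L2 axioms, under the dictionary
`toTheta ↦ QuotientGroup.mk' thetaKer`, `thetaToEll ↦ piThetaToEll`, `Dtp.map toTheta ↦ deltaTpTheta`
(HOME/staging/L2/L2-t1/RENAMES.md):

* `ker_mk_thetaKer_eq` / `ker_toEll_eq` — the kernels ARE the pull-backs of `[[Δ_X,Δ_X],Δ_X]⁻`,
  `[Δ_X,Δ_X]⁻` (the `Δ^tp_X ⊓` in the L3 definitions is redundant: `thetaKer_eq_comap`,
  `ellKer_eq_comap`, from L3's `comap_toHat_deltaHat`);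
* `ker_piThetaToEll_central` / `ker_piThetaToEll_comm` — the kernel of `(Π^tp_X)^Θ ↠ (Π^tp_X)^ell`
  commutes with `(Δ^tp_X)^Θ` and is commutative, via `[Δ_X, [Δ_X,Δ_X]⁻] ≤ [Δ_X,[Δ_X,Δ_X]]⁻`
  (`commutator_topologicalClosure_right_le`: `b ↦ [a,b]` is continuous);
* `continuous_mk_thetaKer`, `continuous_piThetaToEll`, `piThetaToEll_surjective`;
* `ker_piThetaToEll_eq_map` — that kernel is the image of `ellKer`, i.e. the subgroup the L2 root
  calls `Δ_Θ ⊆ (Π^tp_X)^Θ` (`ThetaSetting.DeltaTheta`).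
Through the curve-to-group bridge (ruling η (4), `SemiGraphs/TemperedCurveBridge.lean`, seat
abc-iut-L3-t4) these discharge the corresponding `ThetaSetting` fields for curves. Nothing here
asserts that an `OncePuncturedTemperedGroup` of geometric origin exists; typed ≠ endorsed; no side
is taken on any disputed claim.
-/

noncomputable section

open _root_.Topology
open scoped commutatorElement

namespace Literature.AnabelianGeometry.EtaleTheta

open Literature.AnabelianGeometry.SemiGraphs

universe u

namespace ThetaQuotientFacts

/-! ### A commutator lemma (private helper) -/

section GroupTheory

variable {G : Type*} [Group G] [TopologicalSpace G]

/-- `[A, B⁻] ≤ [A, B]⁻` for subgroups `A`, `B` of a topological group: for fixed `a` the map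
`b ↦ [a, b]` is continuous and carries `B` into `[A, B]`, hence `B⁻` into `[A, B]⁻`. Private helper.
[folklore] -/
private theorem commutator_topologicalClosure_right_le [IsTopologicalGroup G] (A B : Subgroup G) :
    ⁅A, B.topologicalClosure⁆ ≤ (⁅A, B⁆).topologicalClosure := by
  rw [Subgroup.commutator_le]
  intro a ha b hb
  have hc : Continuous fun x : G => a * x * a⁻¹ * x⁻¹ := by fun_prop
  have himg : (fun x : G => a * x * a⁻¹ * x⁻¹) '' (B : Set G) ⊆ (⁅A, B⁆ : Subgroup G) := by
    rintro _ ⟨x, hx, rfl⟩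
    exact Subgroup.commutator_mem_commutator ha hx
  have hb' : b ∈ closure (B : Set G) := by
    rw [← Subgroup.topologicalClosure_coe]; exact hb
  have hmem : a * b * a⁻¹ * b⁻¹ ∈ ((⁅A, B⁆ : Subgroup G).topologicalClosure : Set G) := by
    rw [Subgroup.topologicalClosure_coe]
    exact closure_mono himg (image_closure_subset_closure_image hc ⟨b, hb', rfl⟩)
  rw [commutatorElement_def]
  exact hmem

end GroupTheory

/-! ### The L3 theta quotients satisfy the L2 axioms -/

section Quotients

variable {K : Type u} [Field K] (D : OncePuncturedTemperedGroup K)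

/-- `[Δ_X,[Δ_X,Δ_X]]⁻ ⊆ Δ_X` in `Π_X`. [cite: MochizukiEtTh2009, §1 p.12] -/
theorem doubleCommutator_le_deltaHat : D.doubleCommutator ≤ D.deltaHat :=
  D.doubleCommutator_le_ellKerHat.trans D.ellKerHat_le_deltaHat

/-- The pull-back of `[Δ_X,Δ_X]⁻` to `Π^tp_X` lies in `Δ^tp_X`, so the `Δ^tp_X ⊓ …` in the L3
definition `ellKer` is redundant: `Ker(Π^tp_X ↠ (Π^tp_X)^ell) = toHat⁻¹([Δ_X,Δ_X]⁻)` — the L2 stub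
field `ker_toEll`. [cite: MochizukiEtTh2009, §1 p.12] -/
theorem ellKer_eq_comap : D.ellKer = D.ellKerHat.comap D.toHat.toMonoidHom := by
  change D.delta ⊓ D.ellKerHat.comap D.toHat.toMonoidHom = _
  refine le_antisymm inf_le_right (le_inf ?_ le_rfl)
  rw [← D.comap_toHat_deltaHat]
  exact Subgroup.comap_mono D.ellKerHat_le_deltaHat

/-- Likewise `Ker(Π^tp_X ↠ (Π^tp_X)^Θ) = toHat⁻¹([Δ_X,[Δ_X,Δ_X]]⁻)`.
[cite: MochizukiEtTh2009, §1 p.12] -/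
theorem thetaKer_eq_comap : D.thetaKer = D.doubleCommutator.comap D.toHat.toMonoidHom := by
  change D.delta ⊓ D.doubleCommutator.comap D.toHat.toMonoidHom = _
  refine le_antisymm inf_le_right (le_inf ?_ le_rfl)
  rw [← D.comap_toHat_deltaHat]
  exact Subgroup.comap_mono (doubleCommutator_le_deltaHat D)

/-- `[[Δ_X,Δ_X],Δ_X] = [Δ_X,[Δ_X,Δ_X]]` (the L2 stub writes the bracket on the left, L3 on the
right). [cite: MochizukiEtTh2009, §1 p.12] -/
theorem commutator_commutator_comm :
    ⁅⁅D.deltaHat, D.deltaHat⁆, D.deltaHat⁆ = ⁅D.deltaHat, ⁅D.deltaHat, D.deltaHat⁆⁆ :=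
  Subgroup.commutator_comm _ _

/-- The L2 stub field `ker_toTheta` for the L3 definitions: the kernel of
`Π^tp_X ↠ (Π^tp_X)^Θ = Π^tp_X/thetaKer` is the pull-back of `[[Δ_X,Δ_X],Δ_X]⁻ ⊆ Π_X`.
[cite: MochizukiEtTh2009, §1 p.12] -/
theorem ker_mk_thetaKer_eq :
    (QuotientGroup.mk' D.thetaKer).ker =
      ((⁅⁅D.deltaHat, D.deltaHat⁆, D.deltaHat⁆).topologicalClosure).comap D.toHat.toMonoidHom := by
  rw [QuotientGroup.ker_mk', thetaKer_eq_comap D, commutator_commutator_comm D]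
  rfl

/-- `(Π^tp_X)^Θ ↠ (Π^tp_X)^ell` composed with `Π^tp_X ↠ (Π^tp_X)^Θ` is `Π^tp_X ↠ (Π^tp_X)^ell`.
[cite: MochizukiEtTh2009, §1 p.12] -/
theorem piThetaToEll_comp_mk :
    D.piThetaToEll.comp (QuotientGroup.mk' D.thetaKer) = QuotientGroup.mk' D.ellKer := by
  ext g; rfl

/-- The L2 stub field `ker_toEll` for the L3 definitions: the kernel of
`Π^tp_X ↠ (Π^tp_X)^Θ ↠ (Π^tp_X)^ell` is the pull-back of `[Δ_X,Δ_X]⁻ ⊆ Π_X`.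
[cite: MochizukiEtTh2009, §1 p.12] -/
theorem ker_toEll_eq :
    (D.piThetaToEll.comp (QuotientGroup.mk' D.thetaKer)).ker =
      ((⁅D.deltaHat, D.deltaHat⁆).topologicalClosure).comap D.toHat.toMonoidHom := by
  rw [piThetaToEll_comp_mk D, QuotientGroup.ker_mk', ellKer_eq_comap D]
  rfl

/-- The kernel of `(Π^tp_X)^Θ ↠ (Π^tp_X)^ell` is the image of `Ker(Π^tp_X ↠ (Π^tp_X)^ell)`;
it is the subgroup the L2 side calls `Δ_Θ ⊆ (Π^tp_X)^Θ` (`ThetaSetting.DeltaTheta`).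
[cite: MochizukiEtTh2009, §1 p.12] -/
theorem ker_piThetaToEll_eq_map :
    D.piThetaToEll.ker = D.ellKer.map (QuotientGroup.mk' D.thetaKer) := by
  ext x
  obtain ⟨g, rfl⟩ := QuotientGroup.mk'_surjective D.thetaKer x
  constructor
  · intro hx
    refine ⟨g, ?_, rfl⟩
    rw [MonoidHom.mem_ker] at hx
    have : (QuotientGroup.mk' D.ellKer) g = 1 := by
      rw [← piThetaToEll_comp_mk D]; exact hx
    rwa [QuotientGroup.mk'_apply, QuotientGroup.eq_one_iff] at this
  · rintro ⟨h, hh, hgh⟩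
    rw [← hgh, MonoidHom.mem_ker, ← MonoidHom.comp_apply, piThetaToEll_comp_mk D,
      QuotientGroup.mk'_apply, QuotientGroup.eq_one_iff]
    exact hh

/-- `[Δ_X, [Δ_X,Δ_X]⁻] ⊆ [Δ_X,[Δ_X,Δ_X]]⁻` in `Π_X`. [cite: MochizukiEtTh2009, §1 p.12] -/
theorem commutator_deltaHat_ellKerHat_le : ⁅D.deltaHat, D.ellKerHat⁆ ≤ D.doubleCommutator :=
  commutator_topologicalClosure_right_le _ _

/-- For `y ∈ Δ^tp_X` and `x ∈ Ker(Π^tp_X ↠ (Π^tp_X)^ell)` the commutator `[y, x]` dies in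
`(Π^tp_X)^Θ`: `[y, x] ∈ Ker(Π^tp_X ↠ (Π^tp_X)^Θ)` ("`Δ^Θ_X = Δ_X/[Δ_X,[Δ_X,Δ_X]]`", p. 12).
[cite: MochizukiEtTh2009, §1 p.12] -/
theorem commutatorElement_mem_thetaKer {y x : D.Pi} (hy : y ∈ D.delta) (hx : x ∈ D.ellKer) :
    ⁅y, x⁆ ∈ D.thetaKer := by
  rw [thetaKer_eq_comap D, Subgroup.mem_comap, map_commutatorElement]
  refine commutator_deltaHat_ellKerHat_le D (Subgroup.commutator_mem_commutator ?_ ?_)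
  · exact Subgroup.le_topologicalClosure _ (Subgroup.mem_map_of_mem _ hy)
  · exact Subgroup.mem_comap.mp (Subgroup.mem_inf.mp hx).2

/-- **`Δ_Θ` is central in `(Δ^tp_X)^Θ`** — indeed the kernel of `(Π^tp_X)^Θ ↠ (Π^tp_X)^ell`
commutes with the image `(Δ^tp_X)^Θ` of `Δ^tp_X` ("`1 → Δ_Θ → (Δ^tp_X)^Θ → (Δ^tp_X)^ell → 1`"
arises from the central extension `Δ^Θ_X = Δ_X/[Δ_X,[Δ_X,Δ_X]]`, p. 12). This is the L2 stub
field `ker_thetaToEll_central`, PROVED for the L3 definitions. [cite: MochizukiEtTh2009, §1 p.12] -/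
theorem ker_piThetaToEll_central :
    ∀ x ∈ D.piThetaToEll.ker, ∀ y ∈ D.deltaTpTheta, x * y = y * x := by
  intro x hx y hy
  rw [ker_piThetaToEll_eq_map D] at hx
  obtain ⟨g, hg, rfl⟩ := hx
  obtain ⟨h, hh, rfl⟩ := hy
  rw [← map_mul, ← map_mul, QuotientGroup.mk'_apply, QuotientGroup.mk'_apply,
    QuotientGroup.eq, show (g * h)⁻¹ * (h * g) = ⁅h⁻¹, g⁻¹⁆ by
      simp only [commutatorElement_def, mul_inv_rev, inv_inv, mul_assoc]]
  exact commutatorElement_mem_thetaKer D (inv_mem hh) (inv_mem hg)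

/-- The kernel of `(Π^tp_X)^Θ ↠ (Π^tp_X)^ell` is commutative ("`(≅ Ẑ(1)) Δ_Θ`" is abelian,
p. 12) — the L2 stub field `ker_thetaToEll_comm`, PROVED for the L3 definitions.
[cite: MochizukiEtTh2009, §1 p.12] -/
theorem ker_piThetaToEll_comm :
    ∀ x ∈ D.piThetaToEll.ker, ∀ y ∈ D.piThetaToEll.ker, x * y = y * x := by
  intro x hx y hy
  refine ker_piThetaToEll_central D x hx y ?_
  rw [ker_piThetaToEll_eq_map D] at hy
  obtain ⟨h, hh, rfl⟩ := hy
  exact ⟨h, (Subgroup.mem_inf.mp hh).1, rfl⟩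

/-- `Π^tp_X ↠ (Π^tp_X)^Θ` is continuous (quotient topology) — L2 stub field `continuous_toTheta`.
[cite: MochizukiEtTh2009, §1 p.12] -/
theorem continuous_mk_thetaKer : Continuous (QuotientGroup.mk' D.thetaKer) :=
  QuotientGroup.continuous_mk

/-- `(Π^tp_X)^Θ ↠ (Π^tp_X)^ell` is continuous — L2 stub field `continuous_thetaToEll`.
[cite: MochizukiEtTh2009, §1 p.12] -/
theorem continuous_piThetaToEll : Continuous D.piThetaToEll := by
  refine (QuotientGroup.isQuotientMap_mk D.thetaKer).continuous_iff.mpr ?_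
  change Continuous (D.piThetaToEll.comp (QuotientGroup.mk' D.thetaKer))
  rw [piThetaToEll_comp_mk D]
  exact QuotientGroup.continuous_mk

/-- `(Π^tp_X)^Θ ↠ (Π^tp_X)^ell` is surjective — L2 stub field `thetaToEll_surjective`.
[cite: MochizukiEtTh2009, §1 p.12] -/
theorem piThetaToEll_surjective : Function.Surjective D.piThetaToEll := by
  intro z
  obtain ⟨g, rfl⟩ := QuotientGroup.mk'_surjective D.ellKer z
  exact ⟨QuotientGroup.mk' D.thetaKer g, rfl⟩

end Quotients

end ThetaQuotientFacts

end Literature.AnabelianGeometry.EtaleTheta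

end
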